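/-
Origin: expansion seat `planner-pub-hodgecm-landherr-g5-0`, handover #2 2026-08-18T05:43:48Z (`HOME/pub-hodgecm-landherr-g5/lean/LandherrG5/SumTwoNorms.lean`, md5 6a389bea, 58 lines);
landed by the gen-6 packager in gate run 23 as `HodgeCM/Literature/SumTwoNorms.lean` (verbatim).
-/
/-
Copyright: pub-hodgecm formalisation cell (harness21, 2026). New file (not vendored).
Origin: HOME/pub-hodgecm-landherr-g5/lean/LandherrG5/SumTwoNorms.lean — session planner-pub-hodgecm-landherr-g5-0
(unit pub-hodgecm-landherr-g5, EXPANSION part (c) `Lemma33bLandherr`, generation 5).  WIP module `LandherrG5.SumTwoNorms`;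
intended final place `HodgeCM/Literature/SumTwoNorms.lean` (module `HodgeCM.Literature.SumTwoNorms`).  BY-NAME COROLLARY:
nothing posited, nothing cited, no new `def … : Prop`.
-/
import Summits.HodgeConjecture.HodgeCM.Literature.NormTheoremHolds

set_option autoImplicit false

/-!
# Sums of two norms over a CM field — the arithmetic corollary of Landherr's lemma, unconditionally

Gen 3 recorded, as the STRENGTH WITNESS showing that the typed target `HodgeCM.Lemma33bLandherr` is genuinely
arithmetic (`HodgeCM/Literature/NormTheorem.lean`, `HodgeCM.Literature.sumTwoNorms_of_lemma33bLandherr`):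

> `Lemma33bLandherr →` for every CM field `L` (complex conjugation `σ = conjRingHomK L`) and every `x ∈ L` with
> `σ x = x` and `Re τ(x) > 0` at every embedding `τ : L →+* ℂ`, there are `p q ∈ L` with `p·σ p + q·σ q = x`

(apply the lemma to the hermitian planes `⟨1,1⟩` and `⟨x, x⁻¹⟩`, which have equal sign data and equal discriminant
class, and read off the `(0,0)` entry of `gᴴ·1·g = diag(x, x⁻¹)`).  Since gate run 22 the target is a THEOREM
(`HodgeCM.lemma33bLandherr_holds`, `HodgeCM/Literature/NormTheoremHolds.lean`, proved over the vendored cone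
`HodgeCM/Vendored/H21/**`), so the corollary holds OUTRIGHT: `HodgeCM.Literature.sumTwoNorms` below.  For `L = L₀(√-1)`
it is the classical statement that every totally positive element of the totally real field `L₀` is a sum of four
squares in `L₀` (Siegel 1921) — here for every CM field, as "sum of two `L/L₀`-norms".  Closure
`[propext, Classical.choice, Quot.sound]`.
-/

noncomputable section

namespace HodgeCM

namespace Literature

open _root_.Literature.AlgebraicGeometry.ShimuraVarieties (conjRingHomK)

/-- **Sums of two norms over a CM field, unconditionally.**  For every CM field `L` and every `x ∈ L` fixed by complex
conjugation and positive at every complex embedding (i.e. `x ∈ L₀` totally positive), there are `p q ∈ L` with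
`p·σ p + q·σ q = x` (`σ = conjRingHomK L`).  Proof: gen 3's `sumTwoNorms_of_lemma33bLandherr` fed with the run-22 theorem
`HodgeCM.lemma33bLandherr_holds`. -/
theorem sumTwoNorms (L : CMField) (x : L) (hx : conjRingHomK L x = x) (hpos : ∀ τ : L →+* ℂ, 0 < (τ x).re) :
    ∃ p q : L, p * conjRingHomK L p + q * conjRingHomK L q = x :=
  sumTwoNorms_of_lemma33bLandherr _root_.HodgeCM.lemma33bLandherr_holds L x hx hpos

/-- The same with the two norms written through an arbitrary name for the conjugation: if `s : L →+* L` IS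
`conjRingHomK L`, then every `s`-fixed totally positive `x` is `p·s p + q·s q`.  (Convenience restatement for files that
carry the conjugation as a local name.) -/
theorem sumTwoNorms' (L : CMField) (s : L →+* L) (hs : s = conjRingHomK L) (x : L) (hx : s x = x)
    (hpos : ∀ τ : L →+* ℂ, 0 < (τ x).re) : ∃ p q : L, p * s p + q * s q = x := by
  subst hs
  exact sumTwoNorms L x hx hpos

end Literature

end HodgeCM

end
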